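import Literature.MathematicalPhysics.QuantumFieldTheory.Balaban1983to89.B1Eq324BenfattoSect5FreeStep
import HarnessLib

/-!
# `Balaban1983to89.B1Eq324BenfattoSect5Identification` — [BenfattoEtAl1978] §5 pp. 158–159, (5.31)–(5.35) summed over the tesserae: THE EXTRACTED
# PER-BOX EXPONENTS OF ONE PAVEMENT STEP IDENTIFIED WITH THE FREE-CUMULANT DIFFERENCE «current Hamiltonian minus handed-on Hamiltonian», EXACTLY,
# with the four correction terms displayed — obligation (O1)/(O1′) of the chain assembly as an identity plus two triangle inequalities

statement-level skeleton of published theorems with citation tags; proofs where landed; nothing here is a claim about the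
Yang–Mills mass gap

WHY THIS MODULE (cell `pub-ymgap`, seat `dag-n08-c` gen 19, INTENT-6; node N08 [Balaban1985UV3]).  `…Sect5CollectErrors.ineq47_of_chain` and
`…Sect5PavementChainUpper.ineq46_of_chain` take, per step, the hypothesis (O1) `cumulantSum P̂₀ H^A_J t − cumulantSum P̂₀ H^A_{Γ̄₁} t − idErr ≤ Σ_{□∈B}ℓ(□)`
(resp. (O1′) `Σ_□u(□) ≤ … + idErr`), where the chains' consumer sets `ℓ(□) = E(□) − Err(□)`, `u(□) = E(□) + Err(□)` from the per-box relation
(`…Sect5PerBoxAtPavement.perBox_at_pavement`; `E(□)` = the free-cumulant number of the sibling seat dag-n08-b's `perBox_condField` at the three classes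
`Ψ′₁, Ψ″₁, Ψ₂` of `□`).  dag-n08-b proved the two identities behind (O1): per box `E(□) = Σ_k[Ê₀^T(Ψ₁(□);k) − Ê₀^T(Ψ′₁(□);k)]/k!`
(`…Sect5FreeStep.perBoxE_eq_sum_truncatedExp_sub`) and, summed over the boxes at each order, `= Ê₀^T(X;k) − Ê₀^T(Y;k) − CROSS_k − Σ_□W₂₉(□)`
with `X = H_{Γ₁}+Σ_□(Ψ₁+Ψ₂)(□)`, `Y = H_{Γ₁}+Σ_□(Ψ′₁+Ψ₂)(□)` (`…Sect5FreeStep.sum_truncatedExp_sub_eq_telescope`).  This file sums the orders with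
the `1/k!` weights and rewrites against the two Hamiltonians the chains see: `Σ_□E(□) = [cumulantSum P̂₀ H_J t − cumulantSum P̂₀ H_{Γ̄₁} t] − Σ_{k<t}D_k/(k+1)!`,
`D_k = (Ê₀^T(H_J;k+1) − Ê₀^T(X;k+1)) − (Ê₀^T(H_{Γ̄₁};k+1) − Ê₀^T(Y;k+1)) + CROSS_k + Σ_□W₂₉,k(□)` — EXACTLY — and then (O1)/(O1′) follow for ANY per-box
errors `Err(□)` with `idErr := Σ_□Err(□) + Σ_k(|Ê₀^T(H_J)−Ê₀^T(X)| + |Ê₀^T(H_{Γ̄₁})−Ê₀^T(Y)| + |CROSS_k| + |Σ_□W₂₉,k|)/(k+1)!`.  The four absolute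
values are the LEDGER's business: `|Ê₀^T(H_J)−Ê₀^T(X)|` ⇐ (5.11) in cumulants (`…Sect5HlCumulants`, `H_J` vs `Ĥ_J`) + the `Ψ₃`-removal
(`…Sect5Psi3Cumulants`, `Ĥ_J = X + Σ_□Ψ₃(□)`), `|Ê₀^T(H_{Γ̄₁})−Ê₀^T(Y)|` ⇐ the (5.34) correction (`…Sect5Eq534Cumulants`), `|CROSS_k|` ⇐ `…FreeStepCross(…)`,
`|Σ_□W₂₉,k|` ⇐ Appendix D under `P̂₀`.

DICTIONARY.  `Ê₀^T(S;k)` ↦ `truncatedExp (P0 d α β) S k`; the classes of `□_m` as the explicit triple `![T0,T1,T2]` of `…Sect5PerBoxAtPavement`; the palette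
of the telescope `Option (↥B × Bool)` (`none ↦ H_{Γ₁}`, `(m,false) ↦ Ψ′₁(m)+Ψ₂(m)`, `(m,true) ↦ Ψ″₁(m)`) passed, as in `…Sect5FreeStep`, as a function `Y`
with its three identifications `hYn / hYf / hYt`.

WHAT IS PROVED (theorems only; no definition, no named fact, no `sorry`; axioms standard).
* `cumulantSum_sub_eq_sum_range` (`cumulantSum μ H t − cumulantSum μ H′ t = Σ_{k<t}(Ê^T(H;k+1) − Ê^T(H′;k+1))/(k+1)!`), ★★ `sum_perBoxE_eq` (the identity above),
  ★ `identification_lower` ((O1) for any `Err`), ★ `identification_upper` ((O1′) for any `Err`).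

HONEST SCOPE / NOT HERE.  Exact bookkeeping over landed identities; the bounds on the four displayed terms and the ledger are NOT here.  `BasicLemmaPrinted`
stays OPEN; count-neutral for N08; nothing of [Balaban1985UV3] (41)/(47)/(5) is asserted; nothing about d = 4, the continuum, OS axioms, a mass gap or
the Clay problem.
-/

noncomputable section

open MeasureTheory ProbabilityTheory Finset
open scoped BigOperators Nat

namespace Literature.MathematicalPhysics.QuantumFieldTheory.Balaban1983to89.B1Eq324BenfattoSect5Identification

open _root_.MeasureTheory _root_.ProbabilityTheory
open Literature.Probability.LatticeModels (setPartitions ursellOf cumulantOf)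
open Literature.MathematicalPhysics.QuantumFieldTheory
open Literature.MathematicalPhysics.QuantumFieldTheory.Balaban1983to89.B1Eq324BenfattoLemma
open Literature.MathematicalPhysics.QuantumFieldTheory.Balaban1983to89.B1Eq324BenfattoSect5Boxes
open Literature.MathematicalPhysics.QuantumFieldTheory.Balaban1983to89.B1Eq324BenfattoSect5Eq511
open Literature.MathematicalPhysics.QuantumFieldTheory.Balaban1983to89.B1Eq324BenfattoSect5Eq524
open Literature.MathematicalPhysics.QuantumFieldTheory.Balaban1983to89.B1Eq324BenfattoSect5Eq534
open Literature.MathematicalPhysics.QuantumFieldTheory.Balaban1983to89.B1Eq324BenfattoSect5FreeStep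
  (perBoxE_eq_sum_truncatedExp_sub sum_truncatedExp_sub_eq_telescope)

variable {d : ℕ}

section Identification

variable {α β : ℝ} {s D : ℕ} {κ : ℝ} {a : Coef d} {J : Finset (B1Eq324BenfattoLemma.Site d)} {L w v : ℕ}
  {B : Finset (B1Eq324BenfattoLemma.Site d)}

/-- **The bracket of (4.7) as a sum over `k < t`**: `cumulantSum μ H t − cumulantSum μ H′ t = Σ_{k<t}(Ê^T(H;k+1) − Ê^T(H′;k+1))/(k+1)!` (re-indexing
`Icc 1 t` by `range t`). [cite: BenfattoEtAl1978, (4.7) p.152, (2.7) p.147] -/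
theorem cumulantSum_sub_eq_sum_range (μ : Measure (B1Eq324BenfattoLemma.Site d → ℝ)) (H H' : (B1Eq324BenfattoLemma.Site d → ℝ) → ℝ) (t : ℕ) :
    cumulantSum μ H t - cumulantSum μ H' t =
      ∑ k ∈ Finset.range t, (truncatedExp μ H (k + 1) - truncatedExp μ H' (k + 1)) / ((k + 1)! : ℝ) := by
  unfold cumulantSum
  rw [← Finset.sum_sub_distrib]
  have hIcc : Finset.Icc 1 t = (Finset.range t).map ⟨fun k => k + 1, fun _ _ h => by simpa using h⟩ := by
    ext k
    simp only [Finset.mem_Icc, Finset.mem_map, Finset.mem_range, Function.Embedding.coeFn_mk]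
    constructor
    · rintro ⟨h1, h2⟩
      exact ⟨k - 1, by omega, by omega⟩
    · rintro ⟨j, hj, rfl⟩
      exact ⟨by omega, by omega⟩
  rw [hIcc, Finset.sum_map]
  refine Finset.sum_congr rfl fun k _ => ?_
  simp only [Function.Embedding.coeFn_mk, Nat.factorial]
  push_cast
  ring

/-- **THE EXTRACTED EXPONENTS OF ONE PAVEMENT STEP, SUMMED OVER THE TESSERAE, AGAINST THE TWO HAMILTONIANS THE CHAIN SEES — EXACTLY**: for `A` supported in
`J`, the boxes `□_m, m ∈ B`, the three classes `Ψ′₁(m), Ψ″₁(m), Ψ₂(m)` and `t`,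
`Σ_{m∈B} E(m) = [cumulantSum P̂₀ H^A_J t − cumulantSum P̂₀ H^A_{Γ̄₁(B)} t] − Σ_{k<t} D_k/(k+1)!`,
`D_k = (Ê₀^T(H_J;k+1) − Ê₀^T(X;k+1)) − (Ê₀^T(H_{Γ̄₁};k+1) − Ê₀^T(Y;k+1)) + CROSS_k + Σ_{m∈B}W₂₉,k(m)`, `X = H_{Γ₁}+Σ_m(Ψ₁+Ψ₂)(m)`, `Y = H_{Γ₁}+Σ_m(Ψ′₁+Ψ₂)(m)`,
CROSS and `W₂₉` the sums of `…FreeStep.sum_truncatedExp_sub_eq_telescope` (dag-n08-b's `perBoxE_eq_sum_truncatedExp_sub` per box, the telescope per order, the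
orders summed with weights `1/(k+1)!`). [cite: BenfattoEtAl1978, (5.31)–(5.35) pp.158–159, (4.7) p.152] -/
theorem sum_perBoxE_eq (hα : 0 < α) (hβ : 0 < β) (hJ : CoefSupportedIn a J)
    (Y : Option (↥B × Bool) → (B1Eq324BenfattoLemma.Site d → ℝ) → ℝ)
    (hYn : Y none = fun z => hamiltonian s D κ a (corridors L w B) z)
    (hYf : ∀ m : ↥B, Y (some (m, false)) = fun z => psi1p s D κ a L w v m z + psi2 s D κ a L w m z)
    (hYt : ∀ m : ↥B, Y (some (m, true)) = fun z => psi1pp s D κ a L w v m z) (t : ℕ) :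
    ∑ m ∈ B, ∑ k ∈ Finset.range t,
        (∑ f ∈ univ.filter (fun f : Fin (k + 1) → Fin 3 => (∃ j, f j = 1) ∧ ∀ j, f j ≠ 2),
          ursellOf (fun P : Finset (Fin (k + 1)) => ∫ z, ∏ j ∈ P,
            (∑ p ∈ Finset.Icc 1 s, ∑ Δ ∈ (![fun p => tuplesIn J p (frame4 L w v m) ∪ crossT J p (frame4 L w v m) (frame3 L w v m),
                fun p => (tuplesIn J p (core L w m) \ tuplesIn J p (frame4 L w v m)) ∪
                  (crossT J p (core L w m) (frame3 L w v m) \ crossT J p (frame4 L w v m) (frame3 L w v m)),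
                fun p => crossT J p (frame1 L w m) (frame2 L w m) ∪ tuplesIn J p (frame2 L w m)] :
                  Fin 3 → (p : ℕ) → Finset (Fin p → J)) (f j) p,
              ∑ n ∈ admissible p D, term κ a z p Δ n) ∂P0 d α β) univ) / (k + 1)! =
      (cumulantSum (P0 d α β) (hamiltonian s D κ a J) t - cumulantSum (P0 d α β) (hamiltonian s D κ a (corridorsBar L w v B)) t)
        - ∑ k ∈ Finset.range t,
          (((truncatedExp (P0 d α β) (hamiltonian s D κ a J) (k + 1)
              - truncatedExp (P0 d α β)
                  (fun z => hamiltonian s D κ a (corridors L w B) z + ∑ m ∈ B, (psi1 s D κ a L w v m z + psi2 s D κ a L w m z)) (k + 1))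
            - (truncatedExp (P0 d α β) (hamiltonian s D κ a (corridorsBar L w v B)) (k + 1)
              - truncatedExp (P0 d α β)
                  (fun z => hamiltonian s D κ a (corridors L w B) z + ∑ m ∈ B, (psi1p s D κ a L w v m z + psi2 s D κ a L w m z)) (k + 1)))
            + ∑ f ∈ univ.filter (fun f : Fin (k + 1) → Option (↥B × Bool) =>
                (∃ j m, f j = some (m, true)) ∧ ¬∃ m, ∀ j, f j = some (m, false) ∨ f j = some (m, true)),
                ursellOf (fun P : Finset (Fin (k + 1)) => ∫ z, ∏ j ∈ P, Y (f j) z ∂P0 d α β) univ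
            + ∑ m ∈ B, ∑ f ∈ univ.filter (fun f : Fin (k + 1) → Fin 3 => (∃ j, f j = 1) ∧ ∃ j, f j = 2),
                ursellOf (fun P : Finset (Fin (k + 1)) => ∫ z, ∏ j ∈ P,
                  (![fun z => psi1p s D κ a L w v m z, fun z => psi1pp s D κ a L w v m z, fun z => psi2 s D κ a L w m z] (f j)) z
                    ∂P0 d α β) univ) / (k + 1)! := by
  -- per box: `E(m) = Σ_k [T₀(Ψ₁(m)) − T₀(Ψ′₁(m))]/(k+1)!`
  have hbox : ∀ m ∈ B, ∑ k ∈ Finset.range t,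
      (∑ f ∈ univ.filter (fun f : Fin (k + 1) → Fin 3 => (∃ j, f j = 1) ∧ ∀ j, f j ≠ 2),
        ursellOf (fun P : Finset (Fin (k + 1)) => ∫ z, ∏ j ∈ P,
          (∑ p ∈ Finset.Icc 1 s, ∑ Δ ∈ (![fun p => tuplesIn J p (frame4 L w v m) ∪ crossT J p (frame4 L w v m) (frame3 L w v m),
              fun p => (tuplesIn J p (core L w m) \ tuplesIn J p (frame4 L w v m)) ∪
                (crossT J p (core L w m) (frame3 L w v m) \ crossT J p (frame4 L w v m) (frame3 L w v m)),
              fun p => crossT J p (frame1 L w m) (frame2 L w m) ∪ tuplesIn J p (frame2 L w m)] :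
                Fin 3 → (p : ℕ) → Finset (Fin p → J)) (f j) p,
            ∑ n ∈ admissible p D, term κ a z p Δ n) ∂P0 d α β) univ) / (k + 1)! =
      ∑ k ∈ Finset.range t,
        (truncatedExp (P0 d α β) (psi1 s D κ a L w v m) (k + 1) - truncatedExp (P0 d α β) (psi1p s D κ a L w v m) (k + 1)) / (k + 1)! :=
    fun m _ => perBoxE_eq_sum_truncatedExp_sub (s := s) (D := D) (κ := κ) (L := L) (w := w) (v := v) (m := m) hα hβ hJ _
      (fun p => rfl) (fun p => rfl) t
  rw [Finset.sum_congr rfl hbox, Finset.sum_comm]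
  -- per order: the telescope
  have htel : ∀ k, ∑ m ∈ B, (truncatedExp (P0 d α β) (psi1 s D κ a L w v m) (k + 1)
      - truncatedExp (P0 d α β) (psi1p s D κ a L w v m) (k + 1)) = _ :=
    fun k => sum_truncatedExp_sub_eq_telescope (s := s) (D := D) (κ := κ) (L := L) (w := w) (v := v) (B := B) hα hβ hJ Y hYn hYf hYt k
  have hk : ∀ k ∈ Finset.range t, ∑ m ∈ B, (truncatedExp (P0 d α β) (psi1 s D κ a L w v m) (k + 1)
      - truncatedExp (P0 d α β) (psi1p s D κ a L w v m) (k + 1)) / ((k + 1)! : ℝ) =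
      (∑ m ∈ B, (truncatedExp (P0 d α β) (psi1 s D κ a L w v m) (k + 1)
        - truncatedExp (P0 d α β) (psi1p s D κ a L w v m) (k + 1))) / ((k + 1)! : ℝ) := fun k _ => by
    rw [Finset.sum_div]
  rw [Finset.sum_congr rfl hk]
  simp only [htel]
  rw [cumulantSum_sub_eq_sum_range, ← Finset.sum_sub_distrib]
  refine Finset.sum_congr rfl fun k _ => ?_
  rw [← sub_div]
  congr 1
  ring

/-- **(O1) — THE LOWER IDENTIFICATION BOUND, for any per-box errors `Err(□)`**: with
`idErr := Σ_{m∈B}Err(m) + Σ_{k<t}(|Ê₀^T(H_J)−Ê₀^T(X)| + |Ê₀^T(H_{Γ̄₁})−Ê₀^T(Y)| + |CROSS_k| + |Σ_mW₂₉,k(m)|)/(k+1)!`,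
`[cumulantSum P̂₀ H^A_J t − cumulantSum P̂₀ H^A_{Γ̄₁(B)} t] − idErr ≤ Σ_{m∈B}(E(m) − Err(m))` — the `hE` of `…Sect5CollectErrors.ineq47_of_chain` with
`ℓ(□) := E(□) − Err(□)`. [cite: BenfattoEtAl1978, (5.31)–(5.35) pp.158–159, (4.7) p.152] -/
theorem identification_lower (hα : 0 < α) (hβ : 0 < β) (hJ : CoefSupportedIn a J)
    (Y : Option (↥B × Bool) → (B1Eq324BenfattoLemma.Site d → ℝ) → ℝ)
    (hYn : Y none = fun z => hamiltonian s D κ a (corridors L w B) z)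
    (hYf : ∀ m : ↥B, Y (some (m, false)) = fun z => psi1p s D κ a L w v m z + psi2 s D κ a L w m z)
    (hYt : ∀ m : ↥B, Y (some (m, true)) = fun z => psi1pp s D κ a L w v m z) (t : ℕ) (Err : B1Eq324BenfattoLemma.Site d → ℝ) :
    (cumulantSum (P0 d α β) (hamiltonian s D κ a J) t - cumulantSum (P0 d α β) (hamiltonian s D κ a (corridorsBar L w v B)) t)
        - (∑ m ∈ B, Err m + ∑ k ∈ Finset.range t,
            (|truncatedExp (P0 d α β) (hamiltonian s D κ a J) (k + 1)
                - truncatedExp (P0 d α β)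
                    (fun z => hamiltonian s D κ a (corridors L w B) z + ∑ m ∈ B, (psi1 s D κ a L w v m z + psi2 s D κ a L w m z)) (k + 1)|
              + |truncatedExp (P0 d α β) (hamiltonian s D κ a (corridorsBar L w v B)) (k + 1)
                - truncatedExp (P0 d α β)
                    (fun z => hamiltonian s D κ a (corridors L w B) z + ∑ m ∈ B, (psi1p s D κ a L w v m z + psi2 s D κ a L w m z)) (k + 1)|
              + |∑ f ∈ univ.filter (fun f : Fin (k + 1) → Option (↥B × Bool) =>
                  (∃ j m, f j = some (m, true)) ∧ ¬∃ m, ∀ j, f j = some (m, false) ∨ f j = some (m, true)),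
                  ursellOf (fun P : Finset (Fin (k + 1)) => ∫ z, ∏ j ∈ P, Y (f j) z ∂P0 d α β) univ|
              + |∑ m ∈ B, ∑ f ∈ univ.filter (fun f : Fin (k + 1) → Fin 3 => (∃ j, f j = 1) ∧ ∃ j, f j = 2),
                  ursellOf (fun P : Finset (Fin (k + 1)) => ∫ z, ∏ j ∈ P,
                    (![fun z => psi1p s D κ a L w v m z, fun z => psi1pp s D κ a L w v m z, fun z => psi2 s D κ a L w m z] (f j)) z
                      ∂P0 d α β) univ|) / (k + 1)!) ≤
      ∑ m ∈ B, (∑ k ∈ Finset.range t,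
        (∑ f ∈ univ.filter (fun f : Fin (k + 1) → Fin 3 => (∃ j, f j = 1) ∧ ∀ j, f j ≠ 2),
          ursellOf (fun P : Finset (Fin (k + 1)) => ∫ z, ∏ j ∈ P,
            (∑ p ∈ Finset.Icc 1 s, ∑ Δ ∈ (![fun p => tuplesIn J p (frame4 L w v m) ∪ crossT J p (frame4 L w v m) (frame3 L w v m),
                fun p => (tuplesIn J p (core L w m) \ tuplesIn J p (frame4 L w v m)) ∪
                  (crossT J p (core L w m) (frame3 L w v m) \ crossT J p (frame4 L w v m) (frame3 L w v m)),
                fun p => crossT J p (frame1 L w m) (frame2 L w m) ∪ tuplesIn J p (frame2 L w m)] :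
                  Fin 3 → (p : ℕ) → Finset (Fin p → J)) (f j) p,
              ∑ n ∈ admissible p D, term κ a z p Δ n) ∂P0 d α β) univ) / (k + 1)! - Err m) := by
  rw [Finset.sum_sub_distrib, sum_perBoxE_eq hα hβ hJ Y hYn hYf hYt t]
  have hD : ∀ k ∈ Finset.range t,
      (((truncatedExp (P0 d α β) (hamiltonian s D κ a J) (k + 1)
          - truncatedExp (P0 d α β)
              (fun z => hamiltonian s D κ a (corridors L w B) z + ∑ m ∈ B, (psi1 s D κ a L w v m z + psi2 s D κ a L w m z)) (k + 1))
        - (truncatedExp (P0 d α β) (hamiltonian s D κ a (corridorsBar L w v B)) (k + 1)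
          - truncatedExp (P0 d α β)
              (fun z => hamiltonian s D κ a (corridors L w B) z + ∑ m ∈ B, (psi1p s D κ a L w v m z + psi2 s D κ a L w m z)) (k + 1)))
        + ∑ f ∈ univ.filter (fun f : Fin (k + 1) → Option (↥B × Bool) =>
            (∃ j m, f j = some (m, true)) ∧ ¬∃ m, ∀ j, f j = some (m, false) ∨ f j = some (m, true)),
            ursellOf (fun P : Finset (Fin (k + 1)) => ∫ z, ∏ j ∈ P, Y (f j) z ∂P0 d α β) univ
        + ∑ m ∈ B, ∑ f ∈ univ.filter (fun f : Fin (k + 1) → Fin 3 => (∃ j, f j = 1) ∧ ∃ j, f j = 2),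
            ursellOf (fun P : Finset (Fin (k + 1)) => ∫ z, ∏ j ∈ P,
              (![fun z => psi1p s D κ a L w v m z, fun z => psi1pp s D κ a L w v m z, fun z => psi2 s D κ a L w m z] (f j)) z
                ∂P0 d α β) univ) / (k + 1)! ≤
      (|truncatedExp (P0 d α β) (hamiltonian s D κ a J) (k + 1)
          - truncatedExp (P0 d α β)
              (fun z => hamiltonian s D κ a (corridors L w B) z + ∑ m ∈ B, (psi1 s D κ a L w v m z + psi2 s D κ a L w m z)) (k + 1)|
        + |truncatedExp (P0 d α β) (hamiltonian s D κ a (corridorsBar L w v B)) (k + 1)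
          - truncatedExp (P0 d α β)
              (fun z => hamiltonian s D κ a (corridors L w B) z + ∑ m ∈ B, (psi1p s D κ a L w v m z + psi2 s D κ a L w m z)) (k + 1)|
        + |∑ f ∈ univ.filter (fun f : Fin (k + 1) → Option (↥B × Bool) =>
            (∃ j m, f j = some (m, true)) ∧ ¬∃ m, ∀ j, f j = some (m, false) ∨ f j = some (m, true)),
            ursellOf (fun P : Finset (Fin (k + 1)) => ∫ z, ∏ j ∈ P, Y (f j) z ∂P0 d α β) univ|
        + |∑ m ∈ B, ∑ f ∈ univ.filter (fun f : Fin (k + 1) → Fin 3 => (∃ j, f j = 1) ∧ ∃ j, f j = 2),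
            ursellOf (fun P : Finset (Fin (k + 1)) => ∫ z, ∏ j ∈ P,
              (![fun z => psi1p s D κ a L w v m z, fun z => psi1pp s D κ a L w v m z, fun z => psi2 s D κ a L w m z] (f j)) z
                ∂P0 d α β) univ|) / (k + 1)! := by
    intro k _
    have hfac : (0 : ℝ) < (k + 1)! := by exact_mod_cast Nat.factorial_pos (k + 1)
    refine div_le_div_of_nonneg_right ?_ hfac.le
    have h1 := le_abs_self (truncatedExp (P0 d α β) (hamiltonian s D κ a J) (k + 1)
          - truncatedExp (P0 d α β)
              (fun z => hamiltonian s D κ a (corridors L w B) z + ∑ m ∈ B, (psi1 s D κ a L w v m z + psi2 s D κ a L w m z)) (k + 1))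
    have h2 := neg_abs_le (truncatedExp (P0 d α β) (hamiltonian s D κ a (corridorsBar L w v B)) (k + 1)
          - truncatedExp (P0 d α β)
              (fun z => hamiltonian s D κ a (corridors L w B) z + ∑ m ∈ B, (psi1p s D κ a L w v m z + psi2 s D κ a L w m z)) (k + 1))
    have h3 := le_abs_self (∑ f ∈ univ.filter (fun f : Fin (k + 1) → Option (↥B × Bool) =>
            (∃ j m, f j = some (m, true)) ∧ ¬∃ m, ∀ j, f j = some (m, false) ∨ f j = some (m, true)),
            ursellOf (fun P : Finset (Fin (k + 1)) => ∫ z, ∏ j ∈ P, Y (f j) z ∂P0 d α β) univ)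
    have h4 := le_abs_self (∑ m ∈ B, ∑ f ∈ univ.filter (fun f : Fin (k + 1) → Fin 3 => (∃ j, f j = 1) ∧ ∃ j, f j = 2),
            ursellOf (fun P : Finset (Fin (k + 1)) => ∫ z, ∏ j ∈ P,
              (![fun z => psi1p s D κ a L w v m z, fun z => psi1pp s D κ a L w v m z, fun z => psi2 s D κ a L w m z] (f j)) z
                ∂P0 d α β) univ)
    linarith
  have hsum := Finset.sum_le_sum hD
  linarith

/-- **(O1′) — THE UPPER IDENTIFICATION BOUND, for any per-box errors `Err(□)`**: with the same `idErr`,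
`Σ_{m∈B}(E(m) + Err(m)) ≤ [cumulantSum P̂₀ H^A_J t − cumulantSum P̂₀ H^A_{Γ̄₁(B)} t] + idErr` — the `hE` of `…Sect5PavementChainUpper.ineq46_of_chain` with
`u(□) := E(□) + Err(□)`. [cite: BenfattoEtAl1978, (5.36) p.159, (4.6) p.152] -/
theorem identification_upper (hα : 0 < α) (hβ : 0 < β) (hJ : CoefSupportedIn a J)
    (Y : Option (↥B × Bool) → (B1Eq324BenfattoLemma.Site d → ℝ) → ℝ)
    (hYn : Y none = fun z => hamiltonian s D κ a (corridors L w B) z)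
    (hYf : ∀ m : ↥B, Y (some (m, false)) = fun z => psi1p s D κ a L w v m z + psi2 s D κ a L w m z)
    (hYt : ∀ m : ↥B, Y (some (m, true)) = fun z => psi1pp s D κ a L w v m z) (t : ℕ) (Err : B1Eq324BenfattoLemma.Site d → ℝ) :
    ∑ m ∈ B, (∑ k ∈ Finset.range t,
        (∑ f ∈ univ.filter (fun f : Fin (k + 1) → Fin 3 => (∃ j, f j = 1) ∧ ∀ j, f j ≠ 2),
          ursellOf (fun P : Finset (Fin (k + 1)) => ∫ z, ∏ j ∈ P,
            (∑ p ∈ Finset.Icc 1 s, ∑ Δ ∈ (![fun p => tuplesIn J p (frame4 L w v m) ∪ crossT J p (frame4 L w v m) (frame3 L w v m),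
                fun p => (tuplesIn J p (core L w m) \ tuplesIn J p (frame4 L w v m)) ∪
                  (crossT J p (core L w m) (frame3 L w v m) \ crossT J p (frame4 L w v m) (frame3 L w v m)),
                fun p => crossT J p (frame1 L w m) (frame2 L w m) ∪ tuplesIn J p (frame2 L w m)] :
                  Fin 3 → (p : ℕ) → Finset (Fin p → J)) (f j) p,
              ∑ n ∈ admissible p D, term κ a z p Δ n) ∂P0 d α β) univ) / (k + 1)! + Err m) ≤
      (cumulantSum (P0 d α β) (hamiltonian s D κ a J) t - cumulantSum (P0 d α β) (hamiltonian s D κ a (corridorsBar L w v B)) t)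
        + (∑ m ∈ B, Err m + ∑ k ∈ Finset.range t,
            (|truncatedExp (P0 d α β) (hamiltonian s D κ a J) (k + 1)
                - truncatedExp (P0 d α β)
                    (fun z => hamiltonian s D κ a (corridors L w B) z + ∑ m ∈ B, (psi1 s D κ a L w v m z + psi2 s D κ a L w m z)) (k + 1)|
              + |truncatedExp (P0 d α β) (hamiltonian s D κ a (corridorsBar L w v B)) (k + 1)
                - truncatedExp (P0 d α β)
                    (fun z => hamiltonian s D κ a (corridors L w B) z + ∑ m ∈ B, (psi1p s D κ a L w v m z + psi2 s D κ a L w m z)) (k + 1)|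
              + |∑ f ∈ univ.filter (fun f : Fin (k + 1) → Option (↥B × Bool) =>
                  (∃ j m, f j = some (m, true)) ∧ ¬∃ m, ∀ j, f j = some (m, false) ∨ f j = some (m, true)),
                  ursellOf (fun P : Finset (Fin (k + 1)) => ∫ z, ∏ j ∈ P, Y (f j) z ∂P0 d α β) univ|
              + |∑ m ∈ B, ∑ f ∈ univ.filter (fun f : Fin (k + 1) → Fin 3 => (∃ j, f j = 1) ∧ ∃ j, f j = 2),
                  ursellOf (fun P : Finset (Fin (k + 1)) => ∫ z, ∏ j ∈ P,
                    (![fun z => psi1p s D κ a L w v m z, fun z => psi1pp s D κ a L w v m z, fun z => psi2 s D κ a L w m z] (f j)) z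
                      ∂P0 d α β) univ|) / (k + 1)!) := by
  rw [Finset.sum_add_distrib, sum_perBoxE_eq hα hβ hJ Y hYn hYf hYt t]
  have hD : ∀ k ∈ Finset.range t,
      -((|truncatedExp (P0 d α β) (hamiltonian s D κ a J) (k + 1)
          - truncatedExp (P0 d α β)
              (fun z => hamiltonian s D κ a (corridors L w B) z + ∑ m ∈ B, (psi1 s D κ a L w v m z + psi2 s D κ a L w m z)) (k + 1)|
        + |truncatedExp (P0 d α β) (hamiltonian s D κ a (corridorsBar L w v B)) (k + 1)
          - truncatedExp (P0 d α β)
              (fun z => hamiltonian s D κ a (corridors L w B) z + ∑ m ∈ B, (psi1p s D κ a L w v m z + psi2 s D κ a L w m z)) (k + 1)|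
        + |∑ f ∈ univ.filter (fun f : Fin (k + 1) → Option (↥B × Bool) =>
            (∃ j m, f j = some (m, true)) ∧ ¬∃ m, ∀ j, f j = some (m, false) ∨ f j = some (m, true)),
            ursellOf (fun P : Finset (Fin (k + 1)) => ∫ z, ∏ j ∈ P, Y (f j) z ∂P0 d α β) univ|
        + |∑ m ∈ B, ∑ f ∈ univ.filter (fun f : Fin (k + 1) → Fin 3 => (∃ j, f j = 1) ∧ ∃ j, f j = 2),
            ursellOf (fun P : Finset (Fin (k + 1)) => ∫ z, ∏ j ∈ P,
              (![fun z => psi1p s D κ a L w v m z, fun z => psi1pp s D κ a L w v m z, fun z => psi2 s D κ a L w m z] (f j)) z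
                ∂P0 d α β) univ|) / (k + 1)!) ≤
      (((truncatedExp (P0 d α β) (hamiltonian s D κ a J) (k + 1)
          - truncatedExp (P0 d α β)
              (fun z => hamiltonian s D κ a (corridors L w B) z + ∑ m ∈ B, (psi1 s D κ a L w v m z + psi2 s D κ a L w m z)) (k + 1))
        - (truncatedExp (P0 d α β) (hamiltonian s D κ a (corridorsBar L w v B)) (k + 1)
          - truncatedExp (P0 d α β)
              (fun z => hamiltonian s D κ a (corridors L w B) z + ∑ m ∈ B, (psi1p s D κ a L w v m z + psi2 s D κ a L w m z)) (k + 1)))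
        + ∑ f ∈ univ.filter (fun f : Fin (k + 1) → Option (↥B × Bool) =>
            (∃ j m, f j = some (m, true)) ∧ ¬∃ m, ∀ j, f j = some (m, false) ∨ f j = some (m, true)),
            ursellOf (fun P : Finset (Fin (k + 1)) => ∫ z, ∏ j ∈ P, Y (f j) z ∂P0 d α β) univ
        + ∑ m ∈ B, ∑ f ∈ univ.filter (fun f : Fin (k + 1) → Fin 3 => (∃ j, f j = 1) ∧ ∃ j, f j = 2),
            ursellOf (fun P : Finset (Fin (k + 1)) => ∫ z, ∏ j ∈ P,
              (![fun z => psi1p s D κ a L w v m z, fun z => psi1pp s D κ a L w v m z, fun z => psi2 s D κ a L w m z] (f j)) z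
                ∂P0 d α β) univ) / (k + 1)! := by
    intro k _
    have hfac : (0 : ℝ) < (k + 1)! := by exact_mod_cast Nat.factorial_pos (k + 1)
    rw [← neg_div]
    refine div_le_div_of_nonneg_right ?_ hfac.le
    have h1 := neg_abs_le (truncatedExp (P0 d α β) (hamiltonian s D κ a J) (k + 1)
          - truncatedExp (P0 d α β)
              (fun z => hamiltonian s D κ a (corridors L w B) z + ∑ m ∈ B, (psi1 s D κ a L w v m z + psi2 s D κ a L w m z)) (k + 1))
    have h2 := le_abs_self (truncatedExp (P0 d α β) (hamiltonian s D κ a (corridorsBar L w v B)) (k + 1)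
          - truncatedExp (P0 d α β)
              (fun z => hamiltonian s D κ a (corridors L w B) z + ∑ m ∈ B, (psi1p s D κ a L w v m z + psi2 s D κ a L w m z)) (k + 1))
    have h3 := neg_abs_le (∑ f ∈ univ.filter (fun f : Fin (k + 1) → Option (↥B × Bool) =>
            (∃ j m, f j = some (m, true)) ∧ ¬∃ m, ∀ j, f j = some (m, false) ∨ f j = some (m, true)),
            ursellOf (fun P : Finset (Fin (k + 1)) => ∫ z, ∏ j ∈ P, Y (f j) z ∂P0 d α β) univ)
    have h4 := neg_abs_le (∑ m ∈ B, ∑ f ∈ univ.filter (fun f : Fin (k + 1) → Fin 3 => (∃ j, f j = 1) ∧ ∃ j, f j = 2),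
            ursellOf (fun P : Finset (Fin (k + 1)) => ∫ z, ∏ j ∈ P,
              (![fun z => psi1p s D κ a L w v m z, fun z => psi1pp s D κ a L w v m z, fun z => psi2 s D κ a L w m z] (f j)) z
                ∂P0 d α β) univ)
    linarith
  have hsum := Finset.sum_le_sum hD
  rw [Finset.sum_neg_distrib] at hsum
  linarith

end Identification

end Literature.MathematicalPhysics.QuantumFieldTheory.Balaban1983to89.B1Eq324BenfattoSect5Identification

end
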